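import Summits.CriticalPhenomena.PercolationContinuityZ3.Theorems.Transplant.SkelFrm1ChoiceLT
import HarnessLib

/-!
# N2 (frames-only node `SamePDropOfSkeletonFrm₁`, OPEN), (F) column under (R-32) (J10 ruled, p3-g16 2026-08-23T01:40:38Z; p5 sieve PASS 01:38:26Z):
# **THE KEYSTONE'S BOUNDED INNER-CHAIN HYPOTHESIS FROM THE HANDED-DOWN FACE CHAIN FACT AT TARGET ACCURACY `δT`** —
# `PlanarSkeletonFrm.hchain_of_chainFactQT`: the face obligation `FaceHoldsRNQFnLT Lf dT 𝒞₀` of the closure of record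
# `samePDropOfSkeletonFrm₁_of_choiceFnNQLT` (p3-g16, `SkelFrm1ChoiceLT`) hands the (F) discharger `ChainFactQT Lf G Δ κ (dT κ.δ₂)` (linked chains of
# `n + 1 ≤ Lf κ.K₀ + 1` target steps, forced kits `KitsAtF` at the flat root accuracy `κ.δr 0`, conclusion `1 − dT κ.δ₂`); the (S0) keystone over
# staggered cells `Skelφ.hkits_faceSteps_of_nums9S` (hp-8 g40, SkelPhiFaceKitsOfNums9S) asks its inner-chain fact `hchain` at the KIT accuracy `δ`
# for every chain `0 + 1 + Nr + 1 + N₃ ≤ nF`, concluding at `1 − δ₂ ^ 3` (the forced kit's route datum costs one more factor `δ` than N1's square: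
# `kitClause_frameF`/`hkits_faceStepWNbF` take `hroute : 1 − δ^3 ≤ …`).  This file is the one-step adapter, the N2 twin of `SkelPhiFaceChainFactL`
# (p3-g11/hp-8, N1): for `δ ≤ κ.δr 0` (`TStep.KitsAtF.mono`), `nF ≤ Lf κ.K₀` and `q < 1`, `ChainFactQT … δT` gives `hchain` verbatim with conclusion
# `1 − δT`; the (F) wrapper takes `δT := κ.δ₂ ^ 3` (`dT := fun x => x ^ 3`) — NO `δUP` range anywhere (p5-g16 RIDER A, 02:17:35Z).
# Also the tuple-generic glue `faceHoldsRNQFnLT_of_residue` (the per-point face residue `Skelφ.FaceOblRMOF` ⇒ `FaceHoldsRNQFnLT Lf dT 𝒞₀`).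
builds on p205010 (kernel theorem, internal audit signed; external expert review pending) — nothing in this file uses p205010; nothing here is a
claim about the open node `SamePDropOfSkeletonFrm₁`.
Lane `prim-bschramm`, seat `prim-hp-8` (gen 40; (F) keystone pen); helper file (`--supports stmt-CriticalPhenomena-4575 --as helper`).
[cite: KozmaNitzan2024, §4 Lemma 10 (pp. 17–21), Theorem 6 (pp. 25–31)] [cite: MartineauTassion2017, §4.3]
-/

noncomputable section

open MeasureTheory
open scoped Classical

namespace Summit.CriticalPhenomena.PercolationContinuityZ3.Theorems.Transplant

namespace PlanarSkeletonFrm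

open Literature.Probability.Percolation Literature.Probability.LatticeModels KNLevels
open Literature.Barriers.CriticalPhenomena (HasExponentialGrowth)
open SkelConc (Consts)

variable {V : Type} [DecidableEq V] [Countable V] {G : SimpleGraph V} [G.LocallyFinite]

/-- **The keystone's bounded `hchain` from `ChainFactQT`**: at any kit accuracy `δ ≤ κ.δr 0`, any `q < 1`, any budget `nF ≤ Lf κ.K₀` and any
window radius `r`, the handed-down face chain fact at target accuracy `δT` gives the inner-chain hypothesis of `Skelφ.hkits_faceSteps_of_nums9S`
(shape verbatim, conclusion `1 − δT`; the wrapper's instance is `δT := κ.δ₂ ^ 3`). [cite: KozmaNitzan2024, §4 Lemma 10 (pp. 17–21)] -/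
theorem hchain_of_chainFactQT (Lf : ℕ → ℕ) (κ : Consts) {Δ : ℕ} {δT : ℝ} (hCF : ChainFactQT Lf G Δ κ δT) {q : unitInterval} (hq : (q : ℝ) < 1)
    {δ : ℝ} (hδ : δ ≤ κ.δr 0) {nF : ℕ} (hnF : nF ≤ Lf κ.K₀) (r : ℕ) :
    ∀ (c : V) (Nr N₃ : ℕ), 0 + 1 + Nr + 1 + N₃ ≤ nF → ∀ (W : Sym2 V → unitInterval)
      (s : Fin (0 + 1 + Nr + 1 + N₃ + 1) → TStep (Skel.winGraph G c r)) (T' : Fin (0 + 1 + Nr + 1 + N₃ + 1) → Finset V) (η : ℝ),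
      (∀ i, (s i).L.o = (s 0).L.o) →
      (∀ i : Fin (0 + 1 + Nr + 1 + N₃), T' (Fin.castSucc i) ⊆ (s i.succ).L.X 0) →
      (∀ i, T' i ⊆ (s i).T) →
      (∀ i, (s i).KitsAtF W q Δ δ) →
      η ≤ δ / 2 →
      (∀ i, (prodBernoulli W).real (⋃ t ∈ (s i).T \ T' i, openConn (s 0).L.o t) ≤ η) →
      1 - δ < (prodBernoulli W).real (s 0).L.reachB →
        1 - δT < (prodBernoulli W).real (⋃ t ∈ T' (Fin.last (0 + 1 + Nr + 1 + N₃)), openConn (s 0).L.o t) := by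
  intro c Nr N₃ hn W s T' η ho hlk hT hk hη hex hsrc
  exact hCF (0 + 1 + Nr + 1 + N₃) (hn.trans hnF) q hq c r W s T' η ho hlk hT (fun i => (hk i).mono hδ) (by linarith) hex (by linarith)

/-- **`FaceHoldsRNQFnLT Lf dT 𝒞₀` from the per-point face residue** (tuple-generic glue over `ChoiceFnNQ`; N2 twin of `faceHoldsRNOFnL_of_residue`):
at every `(κ, G, Φ, t, p, hC, O, q)` with `FlatQ`, `ChainFactQT … (dT κ.δ₂)` and `AtQNQ`, the residue
`Skelφ.FaceOblRMOF G (scheme O q) (FD O q) Φ.Δ κ.δ₂` of the choice function's scheme / face data gives the obligation. [folklore] -/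
theorem faceHoldsRNQFnLT_of_residue (Lf : ℕ → ℕ) (dT : ℝ → ℝ) (𝒞₀ : ChoiceFnNQ)
    (h : ∀ (κ : Consts) {V : Type} [DecidableEq V] [Countable V] (G : SimpleGraph V) [G.LocallyFinite] (Φ : PlanarSkeletonFrm G)
      (hg : ¬ HasExponentialGrowth G) (t : V) (ht : t ∈ Φ.types) (h1 : Φ.types = {t}) (p : unitInterval) (hp0 : 0 < (p : ℝ)) (hp1 : (p : ℝ) < 1)
      (hC : Φ.CylSubcritical p) (O : Skelφ.StepI.OutNS V) (q : unitInterval),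
      FlatQ Lf κ → ChainFactQT Lf G Φ.Δ κ (dT κ.δ₂) → (𝒞₀ κ G Φ hg t ht h1 p hp0 hp1 hC).AtQNQ O q →
        Skelφ.FaceOblRMOF G ((𝒞₀ κ G Φ hg t ht h1 p hp0 hp1 hC).scheme O q) ((𝒞₀ κ G Φ hg t ht h1 p hp0 hp1 hC).FD O q) Φ.Δ κ.δ₂) :
    FaceHoldsRNQFnLT Lf dT 𝒞₀ :=
  fun κ _ _ _ G _ Φ hg t ht h1 p hp0 hp1 hC hFl hCF O q hAt => h κ G Φ hg t ht h1 p hp0 hp1 hC O q hFl hCF hAt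

end PlanarSkeletonFrm

end Summit.CriticalPhenomena.PercolationContinuityZ3.Theorems.Transplant

end
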